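import Summits.CriticalPhenomena.PercolationContinuityZ3.Theorems.PercNearOneGluingNoHeavyQuantFarGate3Sub
import Summits.CriticalPhenomena.PercolationContinuityZ3.Theorems.PercNearOneGluingNoHeavyQuantFarGate3Coins
import HarnessLib

/-!
# QUANT lane R8, front "FAR beyond trees", layer one — THE DEGREE-THREE GATE AT THE OBSERVER, X: the mean of the outside count

builds on p205010 (kernel theorem, internal audit signed; external expert review pending)

Support file (`--supports stmt-CriticalPhenomena-4575`), seat `prim-quant-p1` (gen 28); memo
`run/shared/lean/prim/quant/prim-quant-p1-g28/FOR-LEAD-GATE3.md` §1, §5, §7.  Standard axioms; no sorries; no definitions.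

The outside relays `b ∈ B` (`B = A ∖ {v,u₁,u₂}`, `v ∉ B`) are reached through the gate only on specific coin states (file I):
**`Gate3.real_openConn_out_le`** — `P(o ↔ b) ≤ P(o ~ b off v) + p r₁r₂·P(o ≁ b, u₁ ~ b ∨ u₂ ~ b) + p r₁(1−r₂)·P(o ≁ b, u₁ ~ b)
+ p(1−r₁)r₂·P(o ≁ b, u₂ ~ b) + (1−p)r₁r₂·P(o ≁ b, (G₁∨G₂), u₁ ~ b ∨ u₂ ~ b)` (all off `v`).  Summing over `b` and integrating the pointwise
bound `Gate3.sub_pointwise` (file IX) with the generic tool `Gate3.sum₅_real_le_of_pointwise` gives the `sub` row of the reduced LP: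
**`Gate3.sum_real_openConn_out_le`** — `Σ_{b∈B} P(o ↔ b) ≤ Σ_{T,k} sub_{T,k}·P(type T ∧ K-class k)` (14 cells; `K = #{b ∈ B : o ~ b off v}`).
[cite: Grimmett1999, §1.3 p. 10; §2.2]; the bookkeeping is [this work].
-/

noncomputable section

namespace Summit.CriticalPhenomena.PercolationContinuityZ3.Theorems

namespace Quant

namespace Gate3

open Finset MeasureTheory Set
open Literature.Probability.LatticeModels
open Literature.Probability.Percolation
open Bundle (offZ reachable_of_offZ)
open scoped Classical

variable {n : ℕ} {o v u₁ u₂ : Fin n}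

/-! ## A generic integration tool: five families of events against a list of weighted cells -/

/-- The integral of a list-combination of indicators. [folklore] -/
theorem integral_list_indicator (μ : Measure (BondConfig (Fin n))) [IsFiniteMeasure μ] (L : List (ℝ × Set (BondConfig (Fin n)))) :
    Integrable (fun ω => (L.map fun cs => cs.1 * (if ω ∈ cs.2 then (1 : ℝ) else 0)).sum) μ ∧
      ∫ ω, (L.map fun cs => cs.1 * (if ω ∈ cs.2 then (1 : ℝ) else 0)).sum ∂μ = (L.map fun cs => cs.1 * μ.real cs.2).sum := by
  have hmeas : ∀ U : Set (BondConfig (Fin n)), MeasurableSet U := fun U => (Set.toFinite U).measurableSet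
  have hind : ∀ U : Set (BondConfig (Fin n)), Integrable (fun ω => if ω ∈ U then (1 : ℝ) else 0) μ := by
    intro U
    have := (integrable_const (1 : ℝ)).indicator (μ := μ) (hmeas U)
    refine this.congr (Filter.Eventually.of_forall fun ω => ?_)
    exact Set.indicator_apply U (fun _ => (1 : ℝ)) ω
  have hreal : ∀ U : Set (BondConfig (Fin n)), ∫ ω, (if ω ∈ U then (1 : ℝ) else 0) ∂μ = μ.real U := by
    intro U
    rw [← integral_indicator_one (hmeas U)]
    refine integral_congr_ae (Filter.Eventually.of_forall fun ω => ?_)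
    exact (Set.indicator_apply U (fun _ => (1 : ℝ)) ω).symm
  induction L with
  | nil => simp
  | cons cs L ih =>
    obtain ⟨hi, he⟩ := ih
    have h1 : Integrable (fun ω => cs.1 * (if ω ∈ cs.2 then (1 : ℝ) else 0)) μ := (hind cs.2).const_mul cs.1
    refine ⟨?_, ?_⟩
    · simp only [List.map_cons, List.sum_cons]
      exact h1.add hi
    · simp only [List.map_cons, List.sum_cons]
      rw [integral_add h1 hi, he, integral_const_mul, hreal]

/-- **Five families against weighted cells.**  If pointwise `Σ_{k∈s} (c₁1[E₁ k] + … + c₅1[E₅ k]) ≤ Σ_{(c,S)∈L} c·1[S]` then the same holds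
for the probabilities. [folklore] -/
theorem sum₅_real_le_of_pointwise (μ : Measure (BondConfig (Fin n))) [IsFiniteMeasure μ] {κ : Type*} (s : Finset κ)
    (E₁ E₂ E₃ E₄ E₅ : κ → Set (BondConfig (Fin n))) (c₁ c₂ c₃ c₄ c₅ : ℝ) (L : List (ℝ × Set (BondConfig (Fin n))))
    (hpt : ∀ ω, (∑ k ∈ s, (c₁ * (if ω ∈ E₁ k then (1 : ℝ) else 0) + c₂ * (if ω ∈ E₂ k then (1 : ℝ) else 0) +
        c₃ * (if ω ∈ E₃ k then (1 : ℝ) else 0) + c₄ * (if ω ∈ E₄ k then (1 : ℝ) else 0) + c₅ * (if ω ∈ E₅ k then (1 : ℝ) else 0))) ≤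
      (L.map fun cs => cs.1 * (if ω ∈ cs.2 then (1 : ℝ) else 0)).sum) :
    (∑ k ∈ s, (c₁ * μ.real (E₁ k) + c₂ * μ.real (E₂ k) + c₃ * μ.real (E₃ k) + c₄ * μ.real (E₄ k) + c₅ * μ.real (E₅ k))) ≤
      (L.map fun cs => cs.1 * μ.real cs.2).sum := by
  have hmeas : ∀ U : Set (BondConfig (Fin n)), MeasurableSet U := fun U => (Set.toFinite U).measurableSet
  have hind : ∀ U : Set (BondConfig (Fin n)), Integrable (fun ω => if ω ∈ U then (1 : ℝ) else 0) μ := by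
    intro U
    have := (integrable_const (1 : ℝ)).indicator (μ := μ) (hmeas U)
    refine this.congr (Filter.Eventually.of_forall fun ω => ?_)
    exact Set.indicator_apply U (fun _ => (1 : ℝ)) ω
  have hreal : ∀ U : Set (BondConfig (Fin n)), ∫ ω, (if ω ∈ U then (1 : ℝ) else 0) ∂μ = μ.real U := by
    intro U
    rw [← integral_indicator_one (hmeas U)]
    refine integral_congr_ae (Filter.Eventually.of_forall fun ω => ?_)
    exact (Set.indicator_apply U (fun _ => (1 : ℝ)) ω).symm
  -- the summand as a function
  set g : κ → BondConfig (Fin n) → ℝ := fun k ω => c₁ * (if ω ∈ E₁ k then (1 : ℝ) else 0) + c₂ * (if ω ∈ E₂ k then (1 : ℝ) else 0) +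
      c₃ * (if ω ∈ E₃ k then (1 : ℝ) else 0) + c₄ * (if ω ∈ E₄ k then (1 : ℝ) else 0) + c₅ * (if ω ∈ E₅ k then (1 : ℝ) else 0) with hg
  have hgi : ∀ k, Integrable (g k) μ := fun k =>
    (((((hind (E₁ k)).const_mul c₁).add ((hind (E₂ k)).const_mul c₂)).add ((hind (E₃ k)).const_mul c₃)).add
      ((hind (E₄ k)).const_mul c₄)).add ((hind (E₅ k)).const_mul c₅)
  have hgint : ∀ k, ∫ ω, g k ω ∂μ = c₁ * μ.real (E₁ k) + c₂ * μ.real (E₂ k) + c₃ * μ.real (E₃ k) + c₄ * μ.real (E₄ k) + c₅ * μ.real (E₅ k) := by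
    intro k
    have i1 : Integrable (fun ω => c₁ * (if ω ∈ E₁ k then (1 : ℝ) else 0)) μ := (hind (E₁ k)).const_mul c₁
    have i2 : Integrable (fun ω => c₂ * (if ω ∈ E₂ k then (1 : ℝ) else 0)) μ := (hind (E₂ k)).const_mul c₂
    have i3 : Integrable (fun ω => c₃ * (if ω ∈ E₃ k then (1 : ℝ) else 0)) μ := (hind (E₃ k)).const_mul c₃
    have i4 : Integrable (fun ω => c₄ * (if ω ∈ E₄ k then (1 : ℝ) else 0)) μ := (hind (E₄ k)).const_mul c₄
    have i5 : Integrable (fun ω => c₅ * (if ω ∈ E₅ k then (1 : ℝ) else 0)) μ := (hind (E₅ k)).const_mul c₅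
    have i12 : Integrable (fun ω => c₁ * (if ω ∈ E₁ k then (1 : ℝ) else 0) + c₂ * (if ω ∈ E₂ k then (1 : ℝ) else 0)) μ := i1.add i2
    have i123 : Integrable (fun ω => c₁ * (if ω ∈ E₁ k then (1 : ℝ) else 0) + c₂ * (if ω ∈ E₂ k then (1 : ℝ) else 0) +
        c₃ * (if ω ∈ E₃ k then (1 : ℝ) else 0)) μ := i12.add i3
    have i1234 : Integrable (fun ω => c₁ * (if ω ∈ E₁ k then (1 : ℝ) else 0) + c₂ * (if ω ∈ E₂ k then (1 : ℝ) else 0) +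
        c₃ * (if ω ∈ E₃ k then (1 : ℝ) else 0) + c₄ * (if ω ∈ E₄ k then (1 : ℝ) else 0)) μ := i123.add i4
    simp only [hg]
    rw [integral_add i1234 i5, integral_add i123 i4, integral_add i12 i3, integral_add i1 i2, integral_const_mul, integral_const_mul,
      integral_const_mul, integral_const_mul, integral_const_mul, hreal, hreal, hreal, hreal, hreal]
  obtain ⟨hLi, hLe⟩ := integral_list_indicator μ L
  have lhs : (∑ k ∈ s, (c₁ * μ.real (E₁ k) + c₂ * μ.real (E₂ k) + c₃ * μ.real (E₃ k) + c₄ * μ.real (E₄ k) + c₅ * μ.real (E₅ k))) =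
      ∫ ω, (∑ k ∈ s, g k ω) ∂μ := by
    rw [integral_finsetSum s fun k _ => hgi k]
    exact Finset.sum_congr rfl fun k _ => (hgint k).symm
  rw [lhs, ← hLe]
  exact integral_mono (integrable_finsetSum s fun k _ => hgi k) hLi fun ω => hpt ω

/-! ## The law of one outside relay -/

section Law

variable (w : Sym2 (Fin n) → unitInterval)
  (hw : ∀ z : Fin n, z ≠ o → z ≠ u₁ → z ≠ u₂ → z ≠ v → (w s(v, z) : ℝ) = 0)
  (hov : o ≠ v) (h1v : u₁ ≠ v) (h2v : u₂ ≠ v) (ho1 : o ≠ u₁) (ho2 : o ≠ u₂) (h12 : u₁ ≠ u₂)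
include hw hov h1v h2v ho1 ho2 h12

/-- **An outside relay** `b ≠ v`: `P(o ↔ b) ≤ P(o ~ b) + p r₁r₂·P(o ≁ b, u₁~b ∨ u₂~b) + p r₁(1−r₂)·P(o ≁ b, u₁~b) + p(1−r₁)r₂·P(o ≁ b, u₂~b)
+ (1−p)r₁r₂·P(o ≁ b, G₁∨G₂, u₁~b ∨ u₂~b)` (all reachability off `v`). [this work] -/
theorem real_openConn_out_le {b : Fin n} (hbv : b ≠ v) :
    (prodBernoulli w).real (openConn o b) ≤
      (prodBernoulli w).real {ω : BondConfig (Fin n) | offZ {v} ω ∈ openConn o b} +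
        (w s(o, v) : ℝ) * (w s(v, u₁) * w s(v, u₂)) * (prodBernoulli w).real {ω : BondConfig (Fin n) |
          ¬ (openGraph (offZ {v} ω)).Reachable o b ∧ ((openGraph (offZ {v} ω)).Reachable u₁ b ∨ (openGraph (offZ {v} ω)).Reachable u₂ b)} +
        (w s(o, v) : ℝ) * (w s(v, u₁) * (1 - w s(v, u₂))) * (prodBernoulli w).real {ω : BondConfig (Fin n) |
          ¬ (openGraph (offZ {v} ω)).Reachable o b ∧ (openGraph (offZ {v} ω)).Reachable u₁ b} +
        (w s(o, v) : ℝ) * ((1 - w s(v, u₁)) * w s(v, u₂)) * (prodBernoulli w).real {ω : BondConfig (Fin n) |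
          ¬ (openGraph (offZ {v} ω)).Reachable o b ∧ (openGraph (offZ {v} ω)).Reachable u₂ b} +
        (1 - (w s(o, v) : ℝ)) * (w s(v, u₁) * w s(v, u₂)) * (prodBernoulli w).real {ω : BondConfig (Fin n) |
          ¬ (openGraph (offZ {v} ω)).Reachable o b ∧
            ((openGraph (offZ {v} ω)).Reachable o u₁ ∨ (openGraph (offZ {v} ω)).Reachable o u₂) ∧
            ((openGraph (offZ {v} ω)).Reachable u₁ b ∨ (openGraph (offZ {v} ω)).Reachable u₂ b)} := by
  have step : ∀ (P : Prop → Prop → Prop → Prop) (Q : BondConfig (Fin n) → Prop),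
      (∀ ω, (∀ z : Fin n, z ≠ o → z ≠ u₁ → z ≠ u₂ → z ≠ v → s(v, z) ∉ ω) →
        P (s(o, v) ∈ ω) (s(v, u₁) ∈ ω) (s(v, u₂) ∈ ω) → (openGraph ω).Reachable o b → Q (offZ {v} ω)) →
      (prodBernoulli w).real ((openConn o b : Set (BondConfig (Fin n))) ∩
          {ω : BondConfig (Fin n) | P (s(o, v) ∈ ω) (s(v, u₁) ∈ ω) (s(v, u₂) ∈ ω)}) ≤
        (prodBernoulli w).real {ω : BondConfig (Fin n) | P (s(o, v) ∈ ω) (s(v, u₁) ∈ ω) (s(v, u₂) ∈ ω)} *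
          (prodBernoulli w).real {ω | Q (offZ {v} ω)} := by
    intro P Q hPQ
    exact real_inter_state_le w hw _ P Q fun ω hω hP hx => hPQ ω hω hP hx
  have R : ∀ ω : BondConfig (Fin n), (∀ z : Fin n, z ≠ o → z ≠ u₁ → z ≠ u₂ → z ≠ v → s(v, z) ∉ ω) →
      (openGraph ω).Reachable o b → (openGraph (offZ {v} ω)).Reachable o b ∨
        ((s(o, v) ∈ ω ∨ (s(v, u₁) ∈ ω ∧ (openGraph (offZ {v} ω)).Reachable o u₁) ∨
            (s(v, u₂) ∈ ω ∧ (openGraph (offZ {v} ω)).Reachable o u₂)) ∧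
          ((s(v, u₁) ∈ ω ∧ (openGraph (offZ {v} ω)).Reachable u₁ b) ∨
            (s(v, u₂) ∈ ω ∧ (openGraph (offZ {v} ω)).Reachable u₂ b))) :=
    fun ω hω => (reach_iff_of_ne hω hov h1v h2v hbv).1
  -- `P(R ∨ S) ≤ P(R) + P(S)`
  have un : ∀ (S : BondConfig (Fin n) → Prop), (prodBernoulli w).real {ω : BondConfig (Fin n) |
      (openGraph (offZ {v} ω)).Reachable o b ∨ S (offZ {v} ω)} ≤
      (prodBernoulli w).real {ω : BondConfig (Fin n) | (openGraph (offZ {v} ω)).Reachable o b} +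
        (prodBernoulli w).real {ω : BondConfig (Fin n) | S (offZ {v} ω)} := by
    intro S
    rw [Set.setOf_or]
    exact measureReal_union_le _ _
  have b1 := step (fun a b' c => a ∧ b' ∧ c) (fun η => (openGraph η).Reachable o b ∨
      (¬ (openGraph η).Reachable o b ∧ ((openGraph η).Reachable u₁ b ∨ (openGraph η).Reachable u₂ b))) (by
    rintro ω hω ⟨-, -, -⟩ hr
    rcases R ω hω hr with h | ⟨-, ⟨-, h⟩ | ⟨-, h⟩⟩
    · exact Or.inl h
    · by_cases h0 : (openGraph (offZ {v} ω)).Reachable o b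
      · exact Or.inl h0
      · exact Or.inr ⟨h0, Or.inl h⟩
    · by_cases h0 : (openGraph (offZ {v} ω)).Reachable o b
      · exact Or.inl h0
      · exact Or.inr ⟨h0, Or.inr h⟩)
  have b2 := step (fun a b' c => a ∧ b' ∧ ¬ c) (fun η => (openGraph η).Reachable o b ∨
      (¬ (openGraph η).Reachable o b ∧ (openGraph η).Reachable u₁ b)) (by
    rintro ω hω ⟨-, -, h2⟩ hr
    rcases R ω hω hr with h | ⟨-, ⟨-, h⟩ | ⟨h, -⟩⟩
    · exact Or.inl h
    · by_cases h0 : (openGraph (offZ {v} ω)).Reachable o b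
      · exact Or.inl h0
      · exact Or.inr ⟨h0, h⟩
    · exact absurd h h2)
  have b3 := step (fun a b' c => a ∧ ¬ b' ∧ c) (fun η => (openGraph η).Reachable o b ∨
      (¬ (openGraph η).Reachable o b ∧ (openGraph η).Reachable u₂ b)) (by
    rintro ω hω ⟨-, h1, -⟩ hr
    rcases R ω hω hr with h | ⟨-, ⟨h, -⟩ | ⟨-, h⟩⟩
    · exact Or.inl h
    · exact absurd h h1
    · by_cases h0 : (openGraph (offZ {v} ω)).Reachable o b
      · exact Or.inl h0
      · exact Or.inr ⟨h0, h⟩)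
  have b4 := step (fun a b' c => a ∧ ¬ b' ∧ ¬ c) (fun η => (openGraph η).Reachable o b) (by
    rintro ω hω ⟨-, h1, h2⟩ hr
    rcases R ω hω hr with h | ⟨-, ⟨h, -⟩ | ⟨h, -⟩⟩
    · exact h
    · exact absurd h h1
    · exact absurd h h2)
  have b5 := step (fun a b' c => ¬ a ∧ b' ∧ c) (fun η => (openGraph η).Reachable o b ∨
      (¬ (openGraph η).Reachable o b ∧ ((openGraph η).Reachable o u₁ ∨ (openGraph η).Reachable o u₂) ∧
        ((openGraph η).Reachable u₁ b ∨ (openGraph η).Reachable u₂ b))) (by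
    rintro ω hω ⟨hp, -, -⟩ hr
    rcases R ω hω hr with h | ⟨hV, hout⟩
    · exact Or.inl h
    · by_cases h0 : (openGraph (offZ {v} ω)).Reachable o b
      · exact Or.inl h0
      · refine Or.inr ⟨h0, ?_, ?_⟩
        · rcases hV with h | ⟨-, h⟩ | ⟨-, h⟩
          · exact absurd h hp
          · exact Or.inl h
          · exact Or.inr h
        · rcases hout with ⟨-, h⟩ | ⟨-, h⟩
          · exact Or.inl h
          · exact Or.inr h)
  have b6 := step (fun a b' c => ¬ a ∧ b' ∧ ¬ c) (fun η => (openGraph η).Reachable o b) (by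
    rintro ω hω ⟨hp, -, h2⟩ hr
    rcases R ω hω hr with h | ⟨hV, hout⟩
    · exact h
    · rcases hout with ⟨-, h⟩ | ⟨h, -⟩
      · rcases hV with h' | ⟨-, h'⟩ | ⟨h', -⟩
        · exact absurd h' hp
        · exact h'.trans h
        · exact absurd h' h2
      · exact absurd h h2)
  have b7 := step (fun a b' c => ¬ a ∧ ¬ b' ∧ c) (fun η => (openGraph η).Reachable o b) (by
    rintro ω hω ⟨hp, h1, -⟩ hr
    rcases R ω hω hr with h | ⟨hV, hout⟩
    · exact h
    · rcases hout with ⟨h, -⟩ | ⟨-, h⟩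
      · exact absurd h h1
      · rcases hV with h' | ⟨h', -⟩ | ⟨-, h'⟩
        · exact absurd h' hp
        · exact absurd h' h1
        · exact h'.trans h)
  have b8 := step (fun a b' c => ¬ a ∧ ¬ b' ∧ ¬ c) (fun η => (openGraph η).Reachable o b) (by
    rintro ω hω ⟨hp, h1, h2⟩ hr
    rcases R ω hω hr with h | ⟨hV, -⟩
    · exact h
    · rcases hV with h' | ⟨h', -⟩ | ⟨h', -⟩
      · exact absurd h' hp
      · exact absurd h' h1
      · exact absurd h' h2)
  rw [real_state_ooo (v := v) w ho1 ho2 h12] at b1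
  rw [real_state_ooc (v := v) w ho1 ho2 h12] at b2
  rw [real_state_oco (v := v) w ho1 ho2 h12] at b3
  rw [real_state_occ (v := v) w ho1 ho2 h12] at b4
  rw [real_state_coo (v := v) w ho1 ho2 h12] at b5
  rw [real_state_coc (v := v) w ho1 ho2 h12] at b6
  rw [real_state_cco (v := v) w ho1 ho2 h12] at b7
  rw [real_state_ccc (v := v) w ho1 ho2 h12] at b8
  have u1 := un (fun η => ¬ (openGraph η).Reachable o b ∧ ((openGraph η).Reachable u₁ b ∨ (openGraph η).Reachable u₂ b))
  have u2 := un (fun η => ¬ (openGraph η).Reachable o b ∧ (openGraph η).Reachable u₁ b)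
  have u3 := un (fun η => ¬ (openGraph η).Reachable o b ∧ (openGraph η).Reachable u₂ b)
  have u5 := un (fun η => ¬ (openGraph η).Reachable o b ∧ ((openGraph η).Reachable o u₁ ∨ (openGraph η).Reachable o u₂) ∧
      ((openGraph η).Reachable u₁ b ∨ (openGraph η).Reachable u₂ b))
  have hp0 : 0 ≤ (w s(o, v) : ℝ) := (w s(o, v)).2.1
  have hp1 : (w s(o, v) : ℝ) ≤ 1 := (w s(o, v)).2.2
  have hr10 : 0 ≤ (w s(v, u₁) : ℝ) := (w s(v, u₁)).2.1
  have hr11 : (w s(v, u₁) : ℝ) ≤ 1 := (w s(v, u₁)).2.2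
  have hr20 : 0 ≤ (w s(v, u₂) : ℝ) := (w s(v, u₂)).2.1
  have hr21 : (w s(v, u₂) : ℝ) ≤ 1 := (w s(v, u₂)).2.2
  have c1 : 0 ≤ (w s(o, v) : ℝ) * (w s(v, u₁) * w s(v, u₂)) := by positivity
  have c2 : 0 ≤ (w s(o, v) : ℝ) * (w s(v, u₁) * (1 - w s(v, u₂))) := mul_nonneg hp0 (mul_nonneg hr10 (by linarith))
  have c3 : 0 ≤ (w s(o, v) : ℝ) * ((1 - w s(v, u₁)) * w s(v, u₂)) := mul_nonneg hp0 (mul_nonneg (by linarith) hr20)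
  have c5 : 0 ≤ (1 - (w s(o, v) : ℝ)) * (w s(v, u₁) * w s(v, u₂)) := mul_nonneg (by linarith) (mul_nonneg hr10 hr20)
  have v1 := mul_le_mul_of_nonneg_left u1 c1
  have v2 := mul_le_mul_of_nonneg_left u2 c2
  have v3 := mul_le_mul_of_nonneg_left u3 c3
  have v5 := mul_le_mul_of_nonneg_left u5 c5
  have tot : (w s(o, v) : ℝ) * (w s(v, u₁) * w s(v, u₂)) + (w s(o, v) : ℝ) * (w s(v, u₁) * (1 - w s(v, u₂))) +
      (w s(o, v) : ℝ) * ((1 - w s(v, u₁)) * w s(v, u₂)) + (w s(o, v) : ℝ) * ((1 - w s(v, u₁)) * (1 - w s(v, u₂))) +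
      (1 - (w s(o, v) : ℝ)) * (w s(v, u₁) * w s(v, u₂)) + (1 - (w s(o, v) : ℝ)) * (w s(v, u₁) * (1 - w s(v, u₂))) +
      (1 - (w s(o, v) : ℝ)) * ((1 - w s(v, u₁)) * w s(v, u₂)) + (1 - (w s(o, v) : ℝ)) * ((1 - w s(v, u₁)) * (1 - w s(v, u₂))) = 1 := by
    ring
  have e0 : {ω : BondConfig (Fin n) | offZ {v} ω ∈ openConn o b} = {ω : BondConfig (Fin n) | (openGraph (offZ {v} ω)).Reachable o b} := rfl
  rw [e0, real_split₈ (prodBernoulli w) (openConn o b : Set (BondConfig (Fin n))) s(o, v) s(v, u₁) s(v, u₂)]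
  nlinarith [b1, b2, b3, b4, b5, b6, b7, b8, v1, v2, v3, v5, tot, measureReal_nonneg (μ := prodBernoulli w)
    (s := {ω : BondConfig (Fin n) | (openGraph (offZ {v} ω)).Reachable o b})]

/-- **The `sub` row of the reduced LP**: for `B` avoiding `v` (`n = |B|`),
`Σ_{b ∈ B} P(o ↔ b) ≤ Σ_{T,k} sub_{T,k}·P(type T ∧ K-class k)` (14 cells; `K = #{b ∈ B : o ~ b off v}`). [this work] -/
theorem sum_real_openConn_out_le (B : Finset (Fin n)) (hB : v ∉ B) :
    ∑ b ∈ B, (prodBernoulli w).real (openConn o b) ≤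
      (w s(o, v) : ℝ) * max (w s(v, u₁) : ℝ) (w s(v, u₂) : ℝ) * B.card * (prodBernoulli w).real {ω : BondConfig (Fin n) | (¬ (openGraph (offZ {v} ω)).Reachable o u₁ ∧ ¬ (openGraph (offZ {v} ω)).Reachable o u₂ ∧ ¬ (openGraph (offZ {v} ω)).Reachable u₁ u₂) ∧ (B.filter fun b => offZ {v} ω ∈ openConn o b).card = 0} +
      (1 + (w s(o, v) : ℝ) * max (w s(v, u₁) : ℝ) (w s(v, u₂) : ℝ) * (B.card - 1)) * (prodBernoulli w).real {ω : BondConfig (Fin n) | (¬ (openGraph (offZ {v} ω)).Reachable o u₁ ∧ ¬ (openGraph (offZ {v} ω)).Reachable o u₂ ∧ ¬ (openGraph (offZ {v} ω)).Reachable u₁ u₂) ∧ (B.filter fun b => offZ {v} ω ∈ openConn o b).card = 1} +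
      (B.card : ℝ) * (prodBernoulli w).real {ω : BondConfig (Fin n) | (¬ (openGraph (offZ {v} ω)).Reachable o u₁ ∧ ¬ (openGraph (offZ {v} ω)).Reachable o u₂ ∧ ¬ (openGraph (offZ {v} ω)).Reachable u₁ u₂) ∧ 2 ≤ (B.filter fun b => offZ {v} ω ∈ openConn o b).card} +
      (1 - (1 - (w s(o, v) : ℝ)) * (1 - (w s(v, u₁) : ℝ))) * (w s(v, u₂) : ℝ) * B.card * (prodBernoulli w).real {ω : BondConfig (Fin n) | ((openGraph (offZ {v} ω)).Reachable o u₁ ∧ ¬ (openGraph (offZ {v} ω)).Reachable o u₂) ∧ (B.filter fun b => offZ {v} ω ∈ openConn o b).card = 0} +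
      (1 + (1 - (1 - (w s(o, v) : ℝ)) * (1 - (w s(v, u₁) : ℝ))) * (w s(v, u₂) : ℝ) * (B.card - 1)) * (prodBernoulli w).real {ω : BondConfig (Fin n) | ((openGraph (offZ {v} ω)).Reachable o u₁ ∧ ¬ (openGraph (offZ {v} ω)).Reachable o u₂) ∧ (B.filter fun b => offZ {v} ω ∈ openConn o b).card = 1} +
      (B.card : ℝ) * (prodBernoulli w).real {ω : BondConfig (Fin n) | ((openGraph (offZ {v} ω)).Reachable o u₁ ∧ ¬ (openGraph (offZ {v} ω)).Reachable o u₂) ∧ 2 ≤ (B.filter fun b => offZ {v} ω ∈ openConn o b).card} +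
      (1 - (1 - (w s(o, v) : ℝ)) * (1 - (w s(v, u₂) : ℝ))) * (w s(v, u₁) : ℝ) * B.card * (prodBernoulli w).real {ω : BondConfig (Fin n) | ((openGraph (offZ {v} ω)).Reachable o u₂ ∧ ¬ (openGraph (offZ {v} ω)).Reachable o u₁) ∧ (B.filter fun b => offZ {v} ω ∈ openConn o b).card = 0} +
      (1 + (1 - (1 - (w s(o, v) : ℝ)) * (1 - (w s(v, u₂) : ℝ))) * (w s(v, u₁) : ℝ) * (B.card - 1)) * (prodBernoulli w).real {ω : BondConfig (Fin n) | ((openGraph (offZ {v} ω)).Reachable o u₂ ∧ ¬ (openGraph (offZ {v} ω)).Reachable o u₁) ∧ (B.filter fun b => offZ {v} ω ∈ openConn o b).card = 1} +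
      (B.card : ℝ) * (prodBernoulli w).real {ω : BondConfig (Fin n) | ((openGraph (offZ {v} ω)).Reachable o u₂ ∧ ¬ (openGraph (offZ {v} ω)).Reachable o u₁) ∧ 2 ≤ (B.filter fun b => offZ {v} ω ∈ openConn o b).card} +
      (w s(o, v) : ℝ) * (1 - (1 - (w s(v, u₁) : ℝ)) * (1 - (w s(v, u₂) : ℝ))) * B.card * (prodBernoulli w).real {ω : BondConfig (Fin n) | (¬ (openGraph (offZ {v} ω)).Reachable o u₁ ∧ ¬ (openGraph (offZ {v} ω)).Reachable o u₂ ∧ (openGraph (offZ {v} ω)).Reachable u₁ u₂) ∧ (B.filter fun b => offZ {v} ω ∈ openConn o b).card = 0} +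
      (1 + (w s(o, v) : ℝ) * (1 - (1 - (w s(v, u₁) : ℝ)) * (1 - (w s(v, u₂) : ℝ))) * (B.card - 1)) * (prodBernoulli w).real {ω : BondConfig (Fin n) | (¬ (openGraph (offZ {v} ω)).Reachable o u₁ ∧ ¬ (openGraph (offZ {v} ω)).Reachable o u₂ ∧ (openGraph (offZ {v} ω)).Reachable u₁ u₂) ∧ (B.filter fun b => offZ {v} ω ∈ openConn o b).card = 1} +
      (B.card : ℝ) * (prodBernoulli w).real {ω : BondConfig (Fin n) | (¬ (openGraph (offZ {v} ω)).Reachable o u₁ ∧ ¬ (openGraph (offZ {v} ω)).Reachable o u₂ ∧ (openGraph (offZ {v} ω)).Reachable u₁ u₂) ∧ 2 ≤ (B.filter fun b => offZ {v} ω ∈ openConn o b).card} +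
      (1 : ℝ) * (prodBernoulli w).real {ω : BondConfig (Fin n) | ((openGraph (offZ {v} ω)).Reachable o u₁ ∧ (openGraph (offZ {v} ω)).Reachable o u₂) ∧ (B.filter fun b => offZ {v} ω ∈ openConn o b).card = 1} +
      (B.card : ℝ) * (prodBernoulli w).real {ω : BondConfig (Fin n) | ((openGraph (offZ {v} ω)).Reachable o u₁ ∧ (openGraph (offZ {v} ω)).Reachable o u₂) ∧ 2 ≤ (B.filter fun b => offZ {v} ω ∈ openConn o b).card} := by
  have hp0 : 0 ≤ (w s(o, v) : ℝ) := (w s(o, v)).2.1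
  have hp1 : (w s(o, v) : ℝ) ≤ 1 := (w s(o, v)).2.2
  have hr10 : 0 ≤ (w s(v, u₁) : ℝ) := (w s(v, u₁)).2.1
  have hr11 : (w s(v, u₁) : ℝ) ≤ 1 := (w s(v, u₁)).2.2
  have hr20 : 0 ≤ (w s(v, u₂) : ℝ) := (w s(v, u₂)).2.1
  have hr21 : (w s(v, u₂) : ℝ) ≤ 1 := (w s(v, u₂)).2.2
  -- per relay
  have hb : ∀ b ∈ B, (prodBernoulli w).real (openConn o b) ≤
      1 * (prodBernoulli w).real {ω : BondConfig (Fin n) | offZ {v} ω ∈ openConn o b} +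
      (w s(o, v) : ℝ) * ((w s(v, u₁) : ℝ) * (w s(v, u₂) : ℝ)) * (prodBernoulli w).real {ω : BondConfig (Fin n) |
        ¬ (openGraph (offZ {v} ω)).Reachable o b ∧ ((openGraph (offZ {v} ω)).Reachable u₁ b ∨ (openGraph (offZ {v} ω)).Reachable u₂ b)} +
      (w s(o, v) : ℝ) * ((w s(v, u₁) : ℝ) * (1 - (w s(v, u₂) : ℝ))) * (prodBernoulli w).real {ω : BondConfig (Fin n) |
        ¬ (openGraph (offZ {v} ω)).Reachable o b ∧ (openGraph (offZ {v} ω)).Reachable u₁ b} +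
      (w s(o, v) : ℝ) * ((1 - (w s(v, u₁) : ℝ)) * (w s(v, u₂) : ℝ)) * (prodBernoulli w).real {ω : BondConfig (Fin n) |
        ¬ (openGraph (offZ {v} ω)).Reachable o b ∧ (openGraph (offZ {v} ω)).Reachable u₂ b} +
      (1 - (w s(o, v) : ℝ)) * ((w s(v, u₁) : ℝ) * (w s(v, u₂) : ℝ)) * (prodBernoulli w).real {ω : BondConfig (Fin n) |
        ¬ (openGraph (offZ {v} ω)).Reachable o b ∧
          ((openGraph (offZ {v} ω)).Reachable o u₁ ∨ (openGraph (offZ {v} ω)).Reachable o u₂) ∧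
          ((openGraph (offZ {v} ω)).Reachable u₁ b ∨ (openGraph (offZ {v} ω)).Reachable u₂ b)} := by
    intro b hbB
    have hbv : b ≠ v := fun h => hB (h ▸ hbB)
    have := real_openConn_out_le w hw hov h1v h2v ho1 ho2 h12 hbv
    linarith
  have hsum := Finset.sum_le_sum hb
  -- the integrated pointwise bound
  have hint := sum₅_real_le_of_pointwise (prodBernoulli w) B
    (fun b => {ω : BondConfig (Fin n) | offZ {v} ω ∈ openConn o b})
    (fun b => {ω : BondConfig (Fin n) | ¬ (openGraph (offZ {v} ω)).Reachable o b ∧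
      ((openGraph (offZ {v} ω)).Reachable u₁ b ∨ (openGraph (offZ {v} ω)).Reachable u₂ b)})
    (fun b => {ω : BondConfig (Fin n) | ¬ (openGraph (offZ {v} ω)).Reachable o b ∧ (openGraph (offZ {v} ω)).Reachable u₁ b})
    (fun b => {ω : BondConfig (Fin n) | ¬ (openGraph (offZ {v} ω)).Reachable o b ∧ (openGraph (offZ {v} ω)).Reachable u₂ b})
    (fun b => {ω : BondConfig (Fin n) | ¬ (openGraph (offZ {v} ω)).Reachable o b ∧
      ((openGraph (offZ {v} ω)).Reachable o u₁ ∨ (openGraph (offZ {v} ω)).Reachable o u₂) ∧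
      ((openGraph (offZ {v} ω)).Reachable u₁ b ∨ (openGraph (offZ {v} ω)).Reachable u₂ b)})
    1 ((w s(o, v) : ℝ) * ((w s(v, u₁) : ℝ) * (w s(v, u₂) : ℝ))) ((w s(o, v) : ℝ) * ((w s(v, u₁) : ℝ) * (1 - (w s(v, u₂) : ℝ)))) ((w s(o, v) : ℝ) * ((1 - (w s(v, u₁) : ℝ)) * (w s(v, u₂) : ℝ))) ((1 - (w s(o, v) : ℝ)) * ((w s(v, u₁) : ℝ) * (w s(v, u₂) : ℝ)))
    [((w s(o, v) : ℝ) * max (w s(v, u₁) : ℝ) (w s(v, u₂) : ℝ) * B.card, {ω : BondConfig (Fin n) | (¬ (openGraph (offZ {v} ω)).Reachable o u₁ ∧ ¬ (openGraph (offZ {v} ω)).Reachable o u₂ ∧ ¬ (openGraph (offZ {v} ω)).Reachable u₁ u₂) ∧ (B.filter fun b => offZ {v} ω ∈ openConn o b).card = 0}),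
      ((1 + (w s(o, v) : ℝ) * max (w s(v, u₁) : ℝ) (w s(v, u₂) : ℝ) * (B.card - 1)), {ω : BondConfig (Fin n) | (¬ (openGraph (offZ {v} ω)).Reachable o u₁ ∧ ¬ (openGraph (offZ {v} ω)).Reachable o u₂ ∧ ¬ (openGraph (offZ {v} ω)).Reachable u₁ u₂) ∧ (B.filter fun b => offZ {v} ω ∈ openConn o b).card = 1}),
      ((B.card : ℝ), {ω : BondConfig (Fin n) | (¬ (openGraph (offZ {v} ω)).Reachable o u₁ ∧ ¬ (openGraph (offZ {v} ω)).Reachable o u₂ ∧ ¬ (openGraph (offZ {v} ω)).Reachable u₁ u₂) ∧ 2 ≤ (B.filter fun b => offZ {v} ω ∈ openConn o b).card}),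
      ((1 - (1 - (w s(o, v) : ℝ)) * (1 - (w s(v, u₁) : ℝ))) * (w s(v, u₂) : ℝ) * B.card, {ω : BondConfig (Fin n) | ((openGraph (offZ {v} ω)).Reachable o u₁ ∧ ¬ (openGraph (offZ {v} ω)).Reachable o u₂) ∧ (B.filter fun b => offZ {v} ω ∈ openConn o b).card = 0}),
      ((1 + (1 - (1 - (w s(o, v) : ℝ)) * (1 - (w s(v, u₁) : ℝ))) * (w s(v, u₂) : ℝ) * (B.card - 1)), {ω : BondConfig (Fin n) | ((openGraph (offZ {v} ω)).Reachable o u₁ ∧ ¬ (openGraph (offZ {v} ω)).Reachable o u₂) ∧ (B.filter fun b => offZ {v} ω ∈ openConn o b).card = 1}),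
      ((B.card : ℝ), {ω : BondConfig (Fin n) | ((openGraph (offZ {v} ω)).Reachable o u₁ ∧ ¬ (openGraph (offZ {v} ω)).Reachable o u₂) ∧ 2 ≤ (B.filter fun b => offZ {v} ω ∈ openConn o b).card}),
      ((1 - (1 - (w s(o, v) : ℝ)) * (1 - (w s(v, u₂) : ℝ))) * (w s(v, u₁) : ℝ) * B.card, {ω : BondConfig (Fin n) | ((openGraph (offZ {v} ω)).Reachable o u₂ ∧ ¬ (openGraph (offZ {v} ω)).Reachable o u₁) ∧ (B.filter fun b => offZ {v} ω ∈ openConn o b).card = 0}),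
      ((1 + (1 - (1 - (w s(o, v) : ℝ)) * (1 - (w s(v, u₂) : ℝ))) * (w s(v, u₁) : ℝ) * (B.card - 1)), {ω : BondConfig (Fin n) | ((openGraph (offZ {v} ω)).Reachable o u₂ ∧ ¬ (openGraph (offZ {v} ω)).Reachable o u₁) ∧ (B.filter fun b => offZ {v} ω ∈ openConn o b).card = 1}),
      ((B.card : ℝ), {ω : BondConfig (Fin n) | ((openGraph (offZ {v} ω)).Reachable o u₂ ∧ ¬ (openGraph (offZ {v} ω)).Reachable o u₁) ∧ 2 ≤ (B.filter fun b => offZ {v} ω ∈ openConn o b).card}),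
      ((w s(o, v) : ℝ) * (1 - (1 - (w s(v, u₁) : ℝ)) * (1 - (w s(v, u₂) : ℝ))) * B.card, {ω : BondConfig (Fin n) | (¬ (openGraph (offZ {v} ω)).Reachable o u₁ ∧ ¬ (openGraph (offZ {v} ω)).Reachable o u₂ ∧ (openGraph (offZ {v} ω)).Reachable u₁ u₂) ∧ (B.filter fun b => offZ {v} ω ∈ openConn o b).card = 0}),
      ((1 + (w s(o, v) : ℝ) * (1 - (1 - (w s(v, u₁) : ℝ)) * (1 - (w s(v, u₂) : ℝ))) * (B.card - 1)), {ω : BondConfig (Fin n) | (¬ (openGraph (offZ {v} ω)).Reachable o u₁ ∧ ¬ (openGraph (offZ {v} ω)).Reachable o u₂ ∧ (openGraph (offZ {v} ω)).Reachable u₁ u₂) ∧ (B.filter fun b => offZ {v} ω ∈ openConn o b).card = 1}),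
      ((B.card : ℝ), {ω : BondConfig (Fin n) | (¬ (openGraph (offZ {v} ω)).Reachable o u₁ ∧ ¬ (openGraph (offZ {v} ω)).Reachable o u₂ ∧ (openGraph (offZ {v} ω)).Reachable u₁ u₂) ∧ 2 ≤ (B.filter fun b => offZ {v} ω ∈ openConn o b).card}),
      ((1 : ℝ), {ω : BondConfig (Fin n) | ((openGraph (offZ {v} ω)).Reachable o u₁ ∧ (openGraph (offZ {v} ω)).Reachable o u₂) ∧ (B.filter fun b => offZ {v} ω ∈ openConn o b).card = 1}),
      ((B.card : ℝ), {ω : BondConfig (Fin n) | ((openGraph (offZ {v} ω)).Reachable o u₁ ∧ (openGraph (offZ {v} ω)).Reachable o u₂) ∧ 2 ≤ (B.filter fun b => offZ {v} ω ∈ openConn o b).card})]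
    (by
      intro ω
      have hpt := sub_pointwise' (o := o) (u₁ := u₁) (u₂ := u₂) (offZ {v} ω) B hp0 hp1 hr10 hr11 hr20 hr21
      simp only [List.map_cons, List.map_nil, List.sum_cons, List.sum_nil]
      rw [Finset.sum_add_distrib, Finset.sum_add_distrib, Finset.sum_add_distrib, Finset.sum_add_distrib,
        ← Finset.mul_sum, ← Finset.mul_sum, ← Finset.mul_sum, ← Finset.mul_sum, ← Finset.mul_sum]
      convert hpt using 40
      all_goals first | rfl | skip
      all_goals rw [natCast_card_filter]
      all_goals exact Finset.sum_congr rfl fun _ _ => @if_congr _ _ _ (_) (_) _ _ _ _ Iff.rfl rfl rfl)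
  simp only [List.map_cons, List.map_nil, List.sum_cons, List.sum_nil] at hint
  linarith [hsum, hint]

end Law

end Gate3

end Quant

end Summit.CriticalPhenomena.PercolationContinuityZ3.Theorems
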